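import Mathlib
import Literature.NumberTheory.LFunctions.Zhang2022.SkeletonSetting
import HarnessLib

/-!
# Zhang (2022), §15 Lemma 15.3 (repaired object, `D`-dependent bound): the prime-factor power sum
# `Σ_{q∣D} q^{−9/10} ≤ 𝓛^{1/10} + c` and `∏_{q∣D} |1 − q^{−s}|² ≤ C·exp(2𝓛^{1/10})` on `Re s ≥ 9/10`

Topic `Literature/NumberTheory/LFunctions/Zhang2022` (Landau–Siegel audit tree; verdict-neutral).
Y. Zhang, *Discrete mean estimates and the Landau–Siegel zero*, arXiv:2211.02515v1 (2022)
[Zhang2022LandauSiegel] — **an unrefereed manuscript under adjudication; nothing here asserts or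
denies its Theorems 1–2.** ZHANG-L discharge lane, WP15, helper under the v19 leaf
`Typed.Section15C.Lemma153RpI c′` (Lemma 15.3 part 1 for the repaired normaliser, cell RULING 15e:
the analytic continuation `U` of `calU1R` to `Re s ≥ 9/10` carries the `D`-DEPENDENT bound
`‖U(s)‖ ≤ C·exp(2𝓛^{1/10})`, `𝓛 = log D`). The Euler factor of `U` at a prime `q ∣ D` is exactly
`(1 − q^{−s})²` (`χ(q) = 0`), so the `q ∣ D` part of the product is `∏_{q∣D}(1 − q^{−s})²`, of norm at
most `∏_{q∣D}(1 + q^{−9/10})² ≤ exp(2Σ_{q∣D} q^{−9/10})` on `Re s ≥ 9/10`. This file PROVES the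
elementary estimate that makes this `≤ C·exp(2𝓛^{1/10})` with an ABSOLUTE constant `C`:

* `sum_le_sum_range_of_antitoneOn` / `sum_range_le_sum_of_monotoneOn` — rearrangement: for a finite
  set `S ⊂ ℕ` of numbers `≥ 2` (so its `i`-th smallest element is `≥ i + 2`) and `f` antitone
  (`g` monotone) on `[2,∞)`, `Σ_{q∈S} f(q) ≤ Σ_{i<|S|} f(i+2)` (`Σ_{i<|S|} g(i+2) ≤ Σ_{q∈S} g(q)`);
* `sum_range_rpow_neg_le` — `Σ_{i<k}(i+2)^{−9/10} ≤ ∫₁^{k+1} t^{−9/10}dt = 10((k+1)^{1/10} − 1)`;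
* `mul_log_sub_le_sum_range_log` — `(k+1)log(k+1) − k = ∫₁^{k+1} log ≤ Σ_{i<k} log(i+2)`;
* **`sum_primeFactors_rpow_neg_le`** — for EVERY `D : ℕ`,
  `Σ_{q ∈ D.primeFactors} q^{−9/10} ≤ (log D)^{1/10} + 10·exp((10¹⁰+1)/10)`: with `k = ω(D)`,
  `K = k + 1`, the three items above give `LHS ≤ 10K^{1/10}` and `log D ≥ log ∏_{q∣D} q ≥ K(log K − 1)`;
  if `log K ≥ 10¹⁰ + 1` then `(log D)^{1/10} ≥ (10¹⁰K)^{1/10} = 10K^{1/10}`, otherwise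
  `10K^{1/10} ≤ 10·exp((10¹⁰+1)/10)` (an astronomical but absolute constant; no prime-counting
  estimate is used);
* `prod_primeFactors_one_add_rpow_sq_le`, `norm_prod_primeFactors_one_sub_cpow_sq_le` (+ the `ell`
  and `∃ C` forms) — the product bounds quoted above.

All statements hold for every `D` (no "large `D`", no character, no hypothesis (A)).
WHAT THIS IS NOT: anything about Theorems 1–2 / Landau–Siegel zeros; not a statement of the
manuscript (an elementary inequality serving the repaired reading of Lemma 15.3).

## References

* Y. Zhang, arXiv:2211.02515v1 (2022), §15 Lemma 15.3 p. 87; Appendix A p. 105.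
  [cite: Zhang2022LandauSiegel, §15 Lemma 15.3 p.87]
-/

noncomputable section

open Real Finset

namespace Literature.NumberTheory.LFunctions.Zhang2022.Typed.Section15C

/-! ## Rearrangement: the `i`-th smallest element of a set of naturals `≥ 2` is `≥ i + 2` -/

/-- **Rearrangement for an antitone weight**: if every element of the finite set `S ⊂ ℕ` is `≥ 2`
and `f` is antitone on `[2,∞)`, then `Σ_{q∈S} f(q) ≤ Σ_{i<|S|} f(i+2)` (induction on the maximum:
the largest element of `S` is at least `|S| + 1`). (Elementary; serves the `D`-dependent bound of
Lemma 15.3, repaired reading.) [cite: Zhang2022LandauSiegel, §15 Lemma 15.3 p.87] -/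
theorem sum_le_sum_range_of_antitoneOn {f : ℝ → ℝ} (hf : AntitoneOn f (Set.Ici (2 : ℝ))) :
    ∀ S : Finset ℕ, (∀ q ∈ S, 2 ≤ q) →
      ∑ q ∈ S, f q ≤ ∑ i ∈ Finset.range S.card, f ((i : ℝ) + 2) := by
  intro S
  induction S using Finset.induction_on_max with
  | empty => simp
  | insert a s ha ih =>
    intro hS
    have hs2 : ∀ q ∈ s, 2 ≤ q := fun q hq => hS q (Finset.mem_insert_of_mem hq)
    have ha2 : 2 ≤ a := hS a (Finset.mem_insert_self a s)
    have hnot : a ∉ s := fun h => lt_irrefl a (ha a h)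
    rw [Finset.sum_insert hnot, Finset.card_insert_of_notMem hnot, Finset.sum_range_succ]
    have hsub : s ⊆ Finset.Ico 2 a := fun x hx => Finset.mem_Ico.mpr ⟨hs2 x hx, ha x hx⟩
    have hcard : s.card + 2 ≤ a := by
      have h := Finset.card_le_card hsub
      rw [Nat.card_Ico] at h
      omega
    have hfa : f a ≤ f ((s.card : ℝ) + 2) := by
      refine hf ?_ ?_ ?_
      · show (2 : ℝ) ≤ (s.card : ℝ) + 2
        have : (0 : ℝ) ≤ s.card := Nat.cast_nonneg _
        linarith
      · show (2 : ℝ) ≤ (a : ℝ)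
        exact_mod_cast ha2
      · exact_mod_cast hcard
    have := ih hs2
    linarith

/-- **Rearrangement for a monotone weight**: if every element of `S ⊂ ℕ` is `≥ 2` and `g` is
monotone on `[2,∞)`, then `Σ_{i<|S|} g(i+2) ≤ Σ_{q∈S} g(q)`. (Elementary; serves the `D`-dependent bound of
Lemma 15.3, repaired reading.) [cite: Zhang2022LandauSiegel, §15 Lemma 15.3 p.87] -/
theorem sum_range_le_sum_of_monotoneOn {g : ℝ → ℝ} (hg : MonotoneOn g (Set.Ici (2 : ℝ)))
    (S : Finset ℕ) (hS : ∀ q ∈ S, 2 ≤ q) :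
    ∑ i ∈ Finset.range S.card, g ((i : ℝ) + 2) ≤ ∑ q ∈ S, g q := by
  have h := sum_le_sum_range_of_antitoneOn hg.neg S hS
  simp only [Finset.sum_neg_distrib] at h
  linarith

/-! ## Sum–integral comparisons: `Σ_{i<k}(i+2)^{−9/10}` and `Σ_{i<k} log(i+2)` -/

/-- `Σ_{i<k} (i+2)^{−9/10} ≤ ∫₁^{k+1} t^{−9/10} dt = 10((k+1)^{1/10} − 1)`. (Elementary; serves the `D`-dependent bound of
Lemma 15.3, repaired reading.) [cite: Zhang2022LandauSiegel, §15 Lemma 15.3 p.87] -/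
theorem sum_range_rpow_neg_le (k : ℕ) :
    ∑ i ∈ Finset.range k, ((i : ℝ) + 2) ^ (-(9 / 10 : ℝ)) ≤
      10 * (((k : ℝ) + 1) ^ (1 / 10 : ℝ) - 1) := by
  have hanti : AntitoneOn (fun x : ℝ => x ^ (-(9 / 10 : ℝ))) (Set.Icc (1 : ℝ) (1 + k)) := by
    refine (Real.antitoneOn_rpow_Ioi_of_exponent_nonpos (by norm_num)).mono ?_
    intro x hx
    exact lt_of_lt_of_le one_pos hx.1
  have h1 := hanti.sum_le_integral
  have hint : ∫ x in (1 : ℝ)..1 + k, x ^ (-(9 / 10 : ℝ)) =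
      10 * (((k : ℝ) + 1) ^ (1 / 10 : ℝ) - 1) := by
    rw [integral_rpow (Or.inl (by norm_num))]
    have h910 : (-(9 / 10 : ℝ)) + 1 = 1 / 10 := by norm_num
    rw [h910, Real.one_rpow, add_comm (1 : ℝ) (k : ℝ)]
    field_simp
  calc ∑ i ∈ Finset.range k, ((i : ℝ) + 2) ^ (-(9 / 10 : ℝ))
      = ∑ i ∈ Finset.range k, ((1 : ℝ) + ((i + 1 : ℕ) : ℝ)) ^ (-(9 / 10 : ℝ)) := by
        refine Finset.sum_congr rfl fun i _ => ?_
        congr 1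
        push_cast
        ring
    _ ≤ ∫ x in (1 : ℝ)..1 + k, x ^ (-(9 / 10 : ℝ)) := h1
    _ = _ := hint

/-- `(k+1)log(k+1) − k = ∫₁^{k+1} log t dt ≤ Σ_{i<k} log(i+2)`. (Elementary; serves the `D`-dependent bound of
Lemma 15.3, repaired reading.) [cite: Zhang2022LandauSiegel, §15 Lemma 15.3 p.87] -/
theorem mul_log_sub_le_sum_range_log (k : ℕ) :
    ((k : ℝ) + 1) * Real.log ((k : ℝ) + 1) - k ≤ ∑ i ∈ Finset.range k, Real.log ((i : ℝ) + 2) := by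
  have hmono : MonotoneOn Real.log (Set.Icc (1 : ℝ) (1 + k)) := by
    refine Real.strictMonoOn_log.monotoneOn.mono ?_
    intro x hx
    exact lt_of_lt_of_le one_pos hx.1
  have h1 := hmono.integral_le_sum
  have hint : ∫ x in (1 : ℝ)..1 + k, Real.log x = ((k : ℝ) + 1) * Real.log ((k : ℝ) + 1) - k := by
    rw [integral_log, Real.log_one, add_comm (1 : ℝ) (k : ℝ)]
    ring
  calc ((k : ℝ) + 1) * Real.log ((k : ℝ) + 1) - k
      = ∫ x in (1 : ℝ)..1 + k, Real.log x := hint.symm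
    _ ≤ ∑ i ∈ Finset.range k, Real.log ((1 : ℝ) + ((i + 1 : ℕ) : ℝ)) := h1
    _ = ∑ i ∈ Finset.range k, Real.log ((i : ℝ) + 2) := by
        refine Finset.sum_congr rfl fun i _ => ?_
        congr 1
        push_cast
        ring

/-! ## The prime-factor power sum -/

/-- `log D ≥ (k+1)(log(k+1) − 1)` where `k = ω(D)` is the number of prime factors of `D ≠ 0`:
`D ≥ ∏_{q∣D} q` and the `i`-th smallest prime factor is `≥ i + 2`. (Elementary; serves the `D`-dependent bound of
Lemma 15.3, repaired reading.) [cite: Zhang2022LandauSiegel, §15 Lemma 15.3 p.87] -/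
theorem card_primeFactors_mul_log_le_log {D : ℕ} (hD : D ≠ 0) :
    ((D.primeFactors.card : ℝ) + 1) * (Real.log ((D.primeFactors.card : ℝ) + 1) - 1) ≤
      Real.log D := by
  set S := D.primeFactors with hS
  set k := S.card with hk
  have hS2 : ∀ q ∈ S, 2 ≤ q := fun q hq => (Nat.prime_of_mem_primeFactors hq).two_le
  have hmono : MonotoneOn Real.log (Set.Ici (2 : ℝ)) := by
    refine Real.strictMonoOn_log.monotoneOn.mono ?_
    intro x hx
    exact lt_of_lt_of_le (by norm_num) (Set.mem_Ici.mp hx)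
  have h1 := mul_log_sub_le_sum_range_log k
  have h2 : ∑ i ∈ Finset.range k, Real.log ((i : ℝ) + 2) ≤ ∑ q ∈ S, Real.log q :=
    sum_range_le_sum_of_monotoneOn hmono S hS2
  have h3 : ∑ q ∈ S, Real.log (q : ℝ) = Real.log (∏ q ∈ S, (q : ℝ)) := by
    rw [Real.log_prod]
    intro q hq
    have := hS2 q hq
    exact_mod_cast (show q ≠ 0 by omega)
  have h4 : Real.log (∏ q ∈ S, (q : ℝ)) ≤ Real.log D := by
    apply Real.log_le_log
    · refine Finset.prod_pos fun q hq => ?_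
      have := hS2 q hq
      exact_mod_cast (show 0 < q by omega)
    · have hdvd : ∏ q ∈ S, q ∣ D := Nat.prod_primeFactors_dvd D
      have hle : ∏ q ∈ S, q ≤ D := Nat.le_of_dvd (Nat.pos_of_ne_zero hD) hdvd
      have hle' : ((∏ q ∈ S, q : ℕ) : ℝ) ≤ (D : ℝ) := by exact_mod_cast hle
      simpa [Nat.cast_prod] using hle'
  have hk0 : (0 : ℝ) ≤ k := Nat.cast_nonneg _
  calc ((k : ℝ) + 1) * (Real.log ((k : ℝ) + 1) - 1)
      = ((k : ℝ) + 1) * Real.log ((k : ℝ) + 1) - k - 1 := by ring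
    _ ≤ ((k : ℝ) + 1) * Real.log ((k : ℝ) + 1) - k := by linarith
    _ ≤ ∑ i ∈ Finset.range k, Real.log ((i : ℝ) + 2) := h1
    _ ≤ ∑ q ∈ S, Real.log q := h2
    _ = Real.log (∏ q ∈ S, (q : ℝ)) := h3
    _ ≤ Real.log D := h4

/-- `(10¹⁰)^{1/10} = 10`. (Elementary; serves the `D`-dependent bound of
Lemma 15.3, repaired reading.) [cite: Zhang2022LandauSiegel, §15 Lemma 15.3 p.87] -/
theorem ten_pow_ten_rpow_tenth : ((10 : ℝ) ^ 10) ^ (1 / 10 : ℝ) = 10 := by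
  rw [show ((10 : ℝ) ^ 10) = (10 : ℝ) ^ ((10 : ℕ) : ℝ) by rw [Real.rpow_natCast],
    ← Real.rpow_mul (by norm_num)]
  norm_num

/-- **The prime-factor power sum, explicit constant**: for every `D : ℕ`,
`Σ_{q ∈ D.primeFactors} q^{−9/10} ≤ (log D)^{1/10} + 10·exp((10¹⁰ + 1)/10)`.
With `k = ω(D)`, `K = k+1`: `LHS ≤ Σ_{i<k}(i+2)^{−9/10} ≤ 10(K^{1/10} − 1) ≤ 10K^{1/10}`; if
`log K < 10¹⁰ + 1` this is `≤ 10·exp((10¹⁰+1)/10)`; otherwise `log D ≥ K(log K − 1) ≥ 10¹⁰·K`, so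
`(log D)^{1/10} ≥ 10·K^{1/10}`. (Elementary; serves the `D`-dependent bound of
Lemma 15.3, repaired reading.) [cite: Zhang2022LandauSiegel, §15 Lemma 15.3 p.87] -/
theorem sum_primeFactors_rpow_neg_le_explicit (D : ℕ) :
    ∑ q ∈ D.primeFactors, (q : ℝ) ^ (-(9 / 10 : ℝ)) ≤
      Real.log D ^ (1 / 10 : ℝ) + 10 * Real.exp ((10 ^ 10 + 1) / 10) := by
  set S := D.primeFactors with hS
  set k := S.card with hk
  have hS2 : ∀ q ∈ S, 2 ≤ q := fun q hq => (Nat.prime_of_mem_primeFactors hq).two_le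
  have hanti : AntitoneOn (fun x : ℝ => x ^ (-(9 / 10 : ℝ))) (Set.Ici (2 : ℝ)) := by
    refine (Real.antitoneOn_rpow_Ioi_of_exponent_nonpos (by norm_num)).mono ?_
    intro x hx
    exact lt_of_lt_of_le (by norm_num) (Set.mem_Ici.mp hx)
  have step1 : ∑ q ∈ S, (q : ℝ) ^ (-(9 / 10 : ℝ)) ≤
      ∑ i ∈ Finset.range k, ((i : ℝ) + 2) ^ (-(9 / 10 : ℝ)) :=
    sum_le_sum_range_of_antitoneOn hanti S hS2
  have step2 := sum_range_rpow_neg_le k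
  set K : ℝ := (k : ℝ) + 1 with hK
  have hk0 : (0 : ℝ) ≤ k := Nat.cast_nonneg _
  have hK1 : 1 ≤ K := by rw [hK]; linarith
  have hK0 : 0 < K := lt_of_lt_of_le one_pos hK1
  have hlogD : 0 ≤ Real.log D := Real.log_natCast_nonneg D
  have hL0 : 0 ≤ Real.log D ^ (1 / 10 : ℝ) := Real.rpow_nonneg hlogD _
  have hE1 : 1 ≤ Real.exp ((10 ^ 10 + 1) / 10) := Real.one_le_exp (by positivity)
  suffices h : 10 * K ^ (1 / 10 : ℝ) ≤
      Real.log D ^ (1 / 10 : ℝ) + 10 * Real.exp ((10 ^ 10 + 1) / 10) by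
    calc ∑ q ∈ S, (q : ℝ) ^ (-(9 / 10 : ℝ))
        ≤ ∑ i ∈ Finset.range k, ((i : ℝ) + 2) ^ (-(9 / 10 : ℝ)) := step1
      _ ≤ 10 * (K ^ (1 / 10 : ℝ) - 1) := step2
      _ ≤ 10 * K ^ (1 / 10 : ℝ) := by linarith
      _ ≤ _ := h
  by_cases hcase : Real.log K < 10 ^ 10 + 1
  · -- small `K`: `K^{1/10} = exp(log K/10) ≤ exp((10¹⁰+1)/10)`
    have hKpow : K ^ (1 / 10 : ℝ) ≤ Real.exp ((10 ^ 10 + 1) / 10) := by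
      rw [Real.rpow_def_of_pos hK0]
      exact Real.exp_le_exp.mpr (by linarith)
    linarith
  · push Not at hcase
    -- large `K`: then `D ≠ 0` (else `K = 1`) and `log D ≥ K(log K − 1) ≥ 10¹⁰·K`
    have hD0 : D ≠ 0 := by
      rintro rfl
      have hk' : k = 0 := by rw [hk, hS, Nat.primeFactors_zero, Finset.card_empty]
      have : K = 1 := by rw [hK, hk']; simp
      rw [this, Real.log_one] at hcase
      norm_num at hcase
    have step3 : K * (Real.log K - 1) ≤ Real.log D := by
      have := card_primeFactors_mul_log_le_log hD0
      rw [← hS, ← hk] at this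
      exact this
    have hL : K * 10 ^ 10 ≤ Real.log D := by
      refine le_trans ?_ step3
      have : (10 : ℝ) ^ 10 ≤ Real.log K - 1 := by linarith
      exact mul_le_mul_of_nonneg_left this hK0.le
    have hmono : (K * 10 ^ 10) ^ (1 / 10 : ℝ) ≤ Real.log D ^ (1 / 10 : ℝ) :=
      Real.rpow_le_rpow (by positivity) hL (by norm_num)
    have h10 : (K * 10 ^ 10) ^ (1 / 10 : ℝ) = K ^ (1 / 10 : ℝ) * 10 := by
      rw [Real.mul_rpow hK0.le (by positivity), ten_pow_ten_rpow_tenth]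
    rw [h10] at hmono
    have : 0 ≤ 10 * Real.exp ((10 ^ 10 + 1) / 10) := by positivity
    linarith

/-- **The prime-factor power sum** (the shape asked for by the `Lemma153RpI` route):
`∃ c, ∀ D, Σ_{q ∈ D.primeFactors} q^{−9/10} ≤ (log D)^{1/10} + c`. (Elementary; serves the `D`-dependent bound of
Lemma 15.3, repaired reading.) [cite: Zhang2022LandauSiegel, §15 Lemma 15.3 p.87] -/
theorem sum_primeFactors_rpow_neg_le :
    ∃ c : ℝ, ∀ D : ℕ,
      ∑ q ∈ D.primeFactors, (q : ℝ) ^ (-(9 / 10 : ℝ)) ≤ Real.log D ^ (1 / 10 : ℝ) + c :=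
  ⟨10 * Real.exp ((10 ^ 10 + 1) / 10), sum_primeFactors_rpow_neg_le_explicit⟩

/-! ## Product forms: `∏_{q∣D}(1 + q^{−9/10})²` and `‖∏_{q∣D}(1 − q^{−s})²‖` on `Re s ≥ 9/10` -/

/-- `∏_{q ∈ D.primeFactors} (1 + q^{−9/10})² ≤ exp(20·e^{(10¹⁰+1)/10}) · exp(2(log D)^{1/10})` for every
`D` (`1 + x ≤ eˣ` and the power-sum bound). (Elementary; serves the `D`-dependent bound of
Lemma 15.3, repaired reading.) [cite: Zhang2022LandauSiegel, §15 Lemma 15.3 p.87] -/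
theorem prod_primeFactors_one_add_rpow_sq_le (D : ℕ) :
    ∏ q ∈ D.primeFactors, (1 + (q : ℝ) ^ (-(9 / 10 : ℝ))) ^ 2 ≤
      Real.exp (20 * Real.exp ((10 ^ 10 + 1) / 10)) * Real.exp (2 * Real.log D ^ (1 / 10 : ℝ)) := by
  have hsum := sum_primeFactors_rpow_neg_le_explicit D
  rw [Finset.prod_pow, ← Real.exp_add]
  have h0 : 0 ≤ ∏ q ∈ D.primeFactors, (1 + (q : ℝ) ^ (-(9 / 10 : ℝ))) :=
    Finset.prod_nonneg fun q _ => by positivity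
  have h1 : ∏ q ∈ D.primeFactors, (1 + (q : ℝ) ^ (-(9 / 10 : ℝ))) ≤
      Real.exp (∑ q ∈ D.primeFactors, (q : ℝ) ^ (-(9 / 10 : ℝ))) := by
    rw [Real.exp_sum]
    refine Finset.prod_le_prod (fun q _ => by positivity) fun q _ => ?_
    have := Real.add_one_le_exp ((q : ℝ) ^ (-(9 / 10 : ℝ)))
    linarith
  calc (∏ q ∈ D.primeFactors, (1 + (q : ℝ) ^ (-(9 / 10 : ℝ)))) ^ 2
      ≤ (Real.exp (∑ q ∈ D.primeFactors, (q : ℝ) ^ (-(9 / 10 : ℝ)))) ^ 2 :=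
        pow_le_pow_left₀ h0 h1 2
    _ = Real.exp (2 * ∑ q ∈ D.primeFactors, (q : ℝ) ^ (-(9 / 10 : ℝ))) := by
        rw [sq, ← Real.exp_add]
        ring_nf
    _ ≤ _ := Real.exp_le_exp.mpr (by linarith)

/-- At a prime `q` and `Re s ≥ 9/10`: `‖1 − q^{−s}‖ ≤ 1 + q^{−9/10}`. (Elementary; serves the `D`-dependent bound of
Lemma 15.3, repaired reading.) [cite: Zhang2022LandauSiegel, §15 Lemma 15.3 p.87] -/
theorem norm_one_sub_natCast_cpow_neg_le {q : ℕ} (hq : 2 ≤ q) {s : ℂ} (hs : 9 / 10 ≤ s.re) :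
    ‖1 - (q : ℂ) ^ (-s)‖ ≤ 1 + (q : ℝ) ^ (-(9 / 10 : ℝ)) := by
  have hq0 : 0 < q := by omega
  have hq1 : (1 : ℝ) ≤ q := by exact_mod_cast hq0
  calc ‖1 - (q : ℂ) ^ (-s)‖ ≤ ‖(1 : ℂ)‖ + ‖(q : ℂ) ^ (-s)‖ := norm_sub_le _ _
    _ = 1 + (q : ℝ) ^ (-s.re) := by
        rw [norm_one, Complex.norm_natCast_cpow_of_pos hq0, Complex.neg_re]
    _ ≤ 1 + (q : ℝ) ^ (-(9 / 10 : ℝ)) := by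
        have := Real.rpow_le_rpow_of_exponent_le hq1 (show -s.re ≤ -(9 / 10 : ℝ) by linarith)
        linarith

/-- **The `q ∣ D` Euler factors of the repaired `𝒰₁ⱼ` on `Re s ≥ 9/10`**: for every `D` and every
`s` with `Re s ≥ 9/10`, `‖∏_{q ∈ D.primeFactors} (1 − q^{−s})²‖ ≤ exp(20·e^{(10¹⁰+1)/10})·exp(2(log D)^{1/10})`.
[cite: Zhang2022LandauSiegel, §15 Lemma 15.3 p.87] -/
theorem norm_prod_primeFactors_one_sub_cpow_sq_le (D : ℕ) {s : ℂ} (hs : 9 / 10 ≤ s.re) :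
    ‖∏ q ∈ D.primeFactors, (1 - (q : ℂ) ^ (-s)) ^ 2‖ ≤
      Real.exp (20 * Real.exp ((10 ^ 10 + 1) / 10)) * Real.exp (2 * Real.log D ^ (1 / 10 : ℝ)) := by
  refine le_trans ?_ (prod_primeFactors_one_add_rpow_sq_le D)
  rw [norm_prod]
  refine Finset.prod_le_prod (fun q _ => norm_nonneg _) fun q hq => ?_
  have hq2 : 2 ≤ q := (Nat.prime_of_mem_primeFactors hq).two_le
  rw [norm_pow]
  exact pow_le_pow_left₀ (norm_nonneg _) (norm_one_sub_natCast_cpow_neg_le hq2 hs) 2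

/-- The same bound in the tree's notation `𝓛 = Skeleton.ell D` (`= Real.log D`), with the constant
packaged: `∃ C > 0, ∀ D, ∀ s, 9/10 ≤ Re s → ‖∏_{q∣D}(1 − q^{−s})²‖ ≤ C·exp(2𝓛^{1/10})` — the
`D`-dependent bound of the discharge target `Lemma153Rp` for the `q ∣ D` part of the Euler product.
[cite: Zhang2022LandauSiegel, §15 Lemma 15.3 p.87] -/
theorem exists_norm_prod_primeFactors_one_sub_cpow_sq_le_exp_ell :
    ∃ C : ℝ, 0 < C ∧ ∀ (D : ℕ) (s : ℂ), 9 / 10 ≤ s.re →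
      ‖∏ q ∈ D.primeFactors, (1 - (q : ℂ) ^ (-s)) ^ 2‖ ≤
        C * Real.exp (2 * Skeleton.ell D ^ (1 / 10 : ℝ)) :=
  ⟨Real.exp (20 * Real.exp ((10 ^ 10 + 1) / 10)), Real.exp_pos _,
    fun D _ hs => norm_prod_primeFactors_one_sub_cpow_sq_le D hs⟩

/-- Real form in the tree's notation: `∃ C > 0, ∀ D, ∏_{q∣D}(1 + q^{−9/10})² ≤ C·exp(2𝓛^{1/10})`.
[cite: Zhang2022LandauSiegel, §15 Lemma 15.3 p.87] -/
theorem exists_prod_primeFactors_one_add_rpow_sq_le_exp_ell :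
    ∃ C : ℝ, 0 < C ∧ ∀ D : ℕ,
      ∏ q ∈ D.primeFactors, (1 + (q : ℝ) ^ (-(9 / 10 : ℝ))) ^ 2 ≤
        C * Real.exp (2 * Skeleton.ell D ^ (1 / 10 : ℝ)) :=
  ⟨Real.exp (20 * Real.exp ((10 ^ 10 + 1) / 10)), Real.exp_pos _,
    fun D => prod_primeFactors_one_add_rpow_sq_le D⟩

/-- The power sum in the tree's notation: `∃ c, ∀ D, Σ_{q∣D} q^{−9/10} ≤ 𝓛^{1/10} + c`.
[cite: Zhang2022LandauSiegel, §15 Lemma 15.3 p.87] -/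
theorem exists_sum_primeFactors_rpow_neg_le_ell :
    ∃ c : ℝ, ∀ D : ℕ,
      ∑ q ∈ D.primeFactors, (q : ℝ) ^ (-(9 / 10 : ℝ)) ≤ Skeleton.ell D ^ (1 / 10 : ℝ) + c :=
  sum_primeFactors_rpow_neg_le

end Literature.NumberTheory.LFunctions.Zhang2022.Typed.Section15C
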